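import Mathlib.RingTheory.SimpleModule.WedderburnArtin
import Mathlib.RingTheory.LittleWedderburn
import Mathlib.RingTheory.SimpleRing.Matrix
import Mathlib.LinearAlgebra.Charpoly.ToMatrix
import Mathlib.RingTheory.Artinian.Module
import Literature.RepresentationTheory.Semisimple.FiniteFieldDescentFinTwo
import Literature.NumberTheory.Automorphic.RestrictedTensorProductIrreducibleProofs
import HarnessLib

/-!
# Descent of two-dimensional representations to a finite field of definition of the
# characteristic polynomials: the absolutely irreducible case

The second half of Deligne–Serre 1974, Lemme 6.13 for `n = 2` in characteristic-polynomial form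
(see `FiniteFieldDescentFinTwo` for the reducible half and the statement): over an algebraically
closed field `L` containing the finite field `k` (via `j`), a homomorphism `φ : G → GL₂(L)`
without common eigenvector and with all characteristic polynomials in `k[X]` is realisable over
`k` up to characteristic polynomials: there is `ρ : G → GL₂(k)` with `ker φ ≤ ker ρ` and
`det(X - ρ(g)) ↦ det(X - φ(g))`. The proof is the one printed in op. cit. ("l'hypothèse
d'irréductibilité absolue ... la condition sur les polynômes caractéristiques montre alors que
la k'-algèbre engendrée par φ(Φ) provient d'une algèbre centrale simple sur k. Or le groupe de
Brauer d'un corps fini est trivial, comme Wedderburn l'a démontré"): by Burnside (Jacobson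
density, `Representation.exists_asAlgebraHom_apply_eq`) the `φ(g)` span `M₂(L)`; the trace
form shows that the `k`-span `A` of `φ(G)` is a `4`-dimensional `k`-form of `M₂(L)`, a simple
`k`-algebra; by Wedderburn–Artin (`IsSimpleRing.exists_algEquiv_matrix_divisionRing_finite`)
and Wedderburn's little theorem (`littleWedderburn`) `A ≅ M₂(k)`; characteristic polynomials are
compared through the left regular representation (`det(X - ℓ_a) = det(X - a)²`).

* `Literature.RepresentationTheory.Semisimple.exists_descent_fin_two_of_no_common_eigenvector`.

## References

* P. Deligne, J.-P. Serre, *Formes modulaires de poids 1*, Ann. Sci. ÉNS (4) 7 (1974),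
  Lemme 6.13.
* C. W. Curtis, I. Reiner, *Representation theory of finite groups and associative algebras*,
  Wiley (1962), (30.16), (27.4) (Burnside), (68.1).
-/

noncomputable section

open scoped MatrixGroups

open Matrix Polynomial Module

namespace Literature.RepresentationTheory.Semisimple

universe u v w

/-! ### The characteristic polynomial of left multiplication on `M₂(R)` -/

section MulLeft

variable {R : Type*} [CommRing R]

/-- **`det(X - ℓ_c) = det(X - c)²`** for left multiplication `ℓ_c` by `c` on `M₂(R)` (the two
columns are `c`-stable: `M₂(R) ≃ R² × R²` by columns conjugates `ℓ_c` to `c ⊕ c`). [folklore] -/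
theorem charpoly_mulLeft_fin_two (c : Matrix (Fin 2) (Fin 2) R) :
    (LinearMap.mulLeft R c).charpoly = c.charpoly ^ 2 := by
  let e : Matrix (Fin 2) (Fin 2) R ≃ₗ[R] (Fin 2 → R) × (Fin 2 → R) :=
    { toFun := fun m ↦ (fun i ↦ m i 0, fun i ↦ m i 1)
      invFun := fun p ↦ Matrix.of fun i l ↦ ![p.1 i, p.2 i] l
      map_add' := fun _ _ ↦ rfl
      map_smul' := fun _ _ ↦ rfl
      left_inv := fun m ↦ by
        ext i l; fin_cases l <;> rfl
      right_inv := fun p ↦ rfl }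
  have hconj : e.conj (LinearMap.mulLeft R c) = (Matrix.toLin' c).prodMap (Matrix.toLin' c) := by
    apply LinearMap.ext
    intro p
    rw [LinearEquiv.conj_apply_apply, LinearMap.prodMap_apply, Matrix.toLin'_apply,
      LinearMap.mulLeft_apply]
    rfl
  have h1 : (Matrix.toLin' c).charpoly = c.charpoly := by
    rw [← LinearMap.charpoly_toMatrix (Matrix.toLin' c) (Pi.basisFun R (Fin 2)),
      LinearMap.toMatrix_eq_toMatrix', LinearMap.toMatrix'_toLin']
  rw [← e.charpoly_conj, hconj, LinearMap.charpoly_prodMap, h1, sq]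

end MulLeft

/-! ### Burnside: an irreducible `G ⊆ GL₂(L)`, `L` algebraically closed, spans `M₂(L)` -/

section Burnside

variable {L : Type v} [Field L] {G : Type w} [Group G]

/-- Commuting `2 × 2` matrices over an algebraically closed field have a common eigenvector.
[folklore] -/
theorem exists_common_eigenvector_of_commute [IsAlgClosed L] (S : Set (Matrix (Fin 2) (Fin 2) L))
    (hS : ∀ a ∈ S, ∀ b ∈ S, a * b = b * a) :
    ∃ v : Fin 2 → L, v ≠ 0 ∧ ∀ a ∈ S, a *ᵥ v ∈ L ∙ v := by
  classical
  by_cases hsc : ∀ a ∈ S, ∃ c : L, a = c • (1 : Matrix (Fin 2) (Fin 2) L)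
  · refine ⟨Pi.single 0 1, by simp, fun a ha ↦ ?_⟩
    obtain ⟨c, rfl⟩ := hsc a ha
    rw [Matrix.smul_mulVec, Matrix.one_mulVec]
    exact Submodule.smul_mem _ _ (Submodule.mem_span_singleton_self _)
  push Not at hsc
  obtain ⟨a₀, ha₀, hns⟩ := hsc
  obtain ⟨μ, hμ⟩ := Module.End.exists_eigenvalue (Matrix.toLin' a₀)
  obtain ⟨v₀, hv₀⟩ := hμ.exists_hasEigenvector
  have hv₀E : a₀ *ᵥ v₀ = μ • v₀ := by
    rw [← Matrix.toLin'_apply]; exact Module.End.mem_eigenspace_iff.mp hv₀.1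
  set E : Submodule L (Fin 2 → L) := LinearMap.ker (Matrix.toLin' a₀ - μ • LinearMap.id) with hE
  have hmemE : ∀ v, v ∈ E ↔ a₀ *ᵥ v = μ • v := fun v ↦ by
    rw [hE, LinearMap.mem_ker, LinearMap.sub_apply, LinearMap.smul_apply, LinearMap.id_apply,
      Matrix.toLin'_apply, sub_eq_zero]
  have hEtop : E ≠ ⊤ := by
    intro h
    apply hns μ
    rw [← LinearMap.toMatrix'_toLin' a₀]
    have : Matrix.toLin' a₀ = μ • LinearMap.id := by
      apply LinearMap.ext; intro v
      have hv : v ∈ E := h ▸ Submodule.mem_top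
      rw [hmemE] at hv
      rw [Matrix.toLin'_apply, hv, LinearMap.smul_apply, LinearMap.id_apply]
    rw [this, map_smul, LinearMap.toMatrix'_id]
  have hEbot : E ≠ ⊥ := fun h ↦ hv₀.2 ((Submodule.mem_bot L).mp (h ▸ (hmemE v₀).mpr hv₀E))
  have hE1 : finrank L E = 1 := finrank_eq_one_of_ne_bot_of_ne_top hEbot hEtop
  have hmult : ∀ u ∈ E, ∃ c : L, c • v₀ = u := by
    intro u hu
    have hv₀E' : v₀ ∈ E := (hmemE v₀).mpr hv₀E
    have h1 := (finrank_eq_one_iff_of_nonzero' (⟨v₀, hv₀E'⟩ : E)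
      (fun h ↦ hv₀.2 (congrArg Subtype.val h))).mp hE1 ⟨u, hu⟩
    obtain ⟨c, hc⟩ := h1
    exact ⟨c, by simpa using congrArg Subtype.val hc⟩
  refine ⟨v₀, hv₀.2, fun a ha ↦ ?_⟩
  have haE : a *ᵥ v₀ ∈ E := by
    rw [hmemE, Matrix.mulVec_mulVec, hS a₀ ha₀ a ha, ← Matrix.mulVec_mulVec, hv₀E,
      Matrix.mulVec_smul]
  obtain ⟨c, hc⟩ := hmult _ haE
  exact Submodule.mem_span_singleton.mpr ⟨c, hc⟩

/-- **Burnside's theorem for `GL₂`**: if `φ : G → GL₂(L)`, `L` algebraically closed, has no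
common eigenvector, the matrices `φ(g)` span `M₂(L)` (irreducibility + Schur's lemma + the
Jacobson density theorem). (Curtis–Reiner (27.4).) [folklore] -/
theorem span_eq_top_of_no_common_eigenvector [IsAlgClosed L] (φ : G →* GL (Fin 2) L)
    (hirr : ∀ v : Fin 2 → L, v ≠ 0 →
      ∃ g, ((φ g : GL (Fin 2) L) : Matrix (Fin 2) (Fin 2) L) *ᵥ v ∉ L ∙ v) :
    Submodule.span L (Set.range fun g ↦ ((φ g : GL (Fin 2) L) : Matrix (Fin 2) (Fin 2) L)) = ⊤ := by
  classical
  set M : G → Matrix (Fin 2) (Fin 2) L := fun g ↦ ((φ g : GL (Fin 2) L) : Matrix (Fin 2) (Fin 2) L)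
    with hMdef
  set R : Representation L G (Fin 2 → L) :=
    (Representation.ofDistribMulAction L (GL (Fin 2) L) (Fin 2 → L)).comp φ with hRdef
  have hRapply : ∀ (g : G) (v : Fin 2 → L), R g v = M g *ᵥ v := fun _ _ ↦ rfl
  have hRlin : ∀ g, R g = Matrix.toLin' (M g) := fun g ↦
    LinearMap.ext fun v ↦ by rw [hRapply, Matrix.toLin'_apply]
  -- irreducibility
  have hbot : (⊥ : Subrepresentation R).toSubmodule = ⊥ := rfl
  have htop : (⊤ : Subrepresentation R).toSubmodule = ⊤ := rfl
  haveI : Nontrivial (Subrepresentation R) := ⟨⟨⊥, ⊤, fun h ↦ by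
    have h' := congrArg Subrepresentation.toSubmodule h
    rw [hbot, htop] at h'
    exact bot_ne_top h'⟩⟩
  haveI hIrr : Representation.IsIrreducible R := by
    refine ⟨fun W ↦ ?_⟩
    by_contra hW
    rw [not_or] at hW
    have hW0 : W.toSubmodule ≠ ⊥ := fun h ↦ hW.1 (Subrepresentation.toSubmodule_injective
      (by rw [h, hbot]))
    have hW1 : W.toSubmodule ≠ ⊤ := fun h ↦ hW.2 (Subrepresentation.toSubmodule_injective
      (by rw [h, htop]))
    have hWrank : finrank L W.toSubmodule = 1 := finrank_eq_one_of_ne_bot_of_ne_top hW0 hW1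
    obtain ⟨w, hwW, hw0⟩ := Submodule.exists_mem_ne_zero_of_ne_bot hW0
    obtain ⟨g, hg⟩ := hirr w hw0
    apply hg
    have h1 := (finrank_eq_one_iff_of_nonzero' (⟨w, hwW⟩ : W.toSubmodule)
      (fun h ↦ hw0 (congrArg Subtype.val h))).mp hWrank ⟨_, W.apply_mem_toSubmodule g hwW⟩
    obtain ⟨c, hc⟩ := h1
    exact Submodule.mem_span_singleton.mpr ⟨c, by simpa [hRapply] using congrArg Subtype.val hc⟩
  -- Schur's lemma
  have hs : ∀ T : (Fin 2 → L) →ₗ[L] (Fin 2 → L), (∀ g : G, T ∘ₗ R g = R g ∘ₗ T) →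
      ∃ c : L, T = c • LinearMap.id := by
    intro T hT
    obtain ⟨c, hc⟩ := Module.End.exists_eigenvalue T
    obtain ⟨v₀, hv₀⟩ := hc.exists_hasEigenvector
    let K : Subrepresentation R :=
      ⟨LinearMap.ker (T - c • LinearMap.id), fun g v hv ↦ by
        rw [LinearMap.mem_ker, LinearMap.sub_apply, LinearMap.smul_apply, LinearMap.id_apply,
          sub_eq_zero] at hv ⊢
        rw [← LinearMap.comp_apply, hT g, LinearMap.comp_apply, hv, map_smul]⟩
    have hK : K ≠ ⊥ := by
      intro h
      have h' : (LinearMap.ker (T - c • LinearMap.id) : Submodule L (Fin 2 → L)) = ⊥ := by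
        have := congrArg Subrepresentation.toSubmodule h
        rw [hbot] at this; exact this
      apply hv₀.2
      rw [← Submodule.mem_bot L, ← h', LinearMap.mem_ker, LinearMap.sub_apply,
        LinearMap.smul_apply, LinearMap.id_apply, sub_eq_zero]
      exact Module.End.mem_eigenspace_iff.mp hv₀.1
    have hKtop : K = ⊤ := (eq_bot_or_eq_top K).resolve_left hK
    refine ⟨c, LinearMap.ext fun v ↦ ?_⟩
    have hv : v ∈ K.toSubmodule := by rw [hKtop, htop]; exact Submodule.mem_top
    change v ∈ LinearMap.ker (T - c • LinearMap.id) at hv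
    rw [LinearMap.mem_ker, LinearMap.sub_apply, LinearMap.smul_apply, LinearMap.id_apply,
      sub_eq_zero] at hv
    rw [hv, LinearMap.smul_apply, LinearMap.id_apply]
  -- density
  rw [eq_top_iff]
  rintro X -
  obtain ⟨r, hr⟩ := Representation.exists_asAlgebraHom_apply_eq hs
    (Finset.univ.image fun i : Fin 2 ↦ (Pi.single i 1 : Fin 2 → L)) (Matrix.toLin' X)
  have hrX : R.asAlgebraHom r = Matrix.toLin' X := by
    refine (Pi.basisFun L (Fin 2)).ext fun i ↦ ?_
    rw [Pi.basisFun_apply]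
    exact hr _ (Finset.mem_image.mpr ⟨i, Finset.mem_univ _, rfl⟩)
  have hmem : R.asAlgebraHom r ∈ Submodule.span L (Set.range fun g ↦ (R g : (Fin 2 → L) →ₗ[L] (Fin 2 → L))) := by
    rw [Representation.asAlgebraHom_def, MonoidAlgebra.lift_apply, Finsupp.sum]
    exact Submodule.sum_mem _ fun g _ ↦ Submodule.smul_mem _ _ (Submodule.subset_span ⟨g, rfl⟩)
  have himage := Submodule.mem_map_of_mem (f := (LinearMap.toMatrix' : ((Fin 2 → L) →ₗ[L] (Fin 2 → L)) ≃ₗ[L] Matrix (Fin 2) (Fin 2) L).toLinearMap) hmem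
  rw [hrX, Submodule.map_span, ← Set.range_comp] at himage
  have hX : (LinearMap.toMatrix' : ((Fin 2 → L) →ₗ[L] (Fin 2 → L)) ≃ₗ[L] _).toLinearMap (Matrix.toLin' X) = X :=
    LinearMap.toMatrix'_toLin' X
  rw [hX] at himage
  have hcomp : ((LinearMap.toMatrix' : ((Fin 2 → L) →ₗ[L] (Fin 2 → L)) ≃ₗ[L] _).toLinearMap ∘
      fun g ↦ (R g : (Fin 2 → L) →ₗ[L] (Fin 2 → L))) = M := by
    funext g
    simp only [Function.comp_apply, LinearEquiv.coe_coe, hRlin, LinearMap.toMatrix'_toLin']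
  rw [hcomp] at himage
  exact himage

end Burnside

/-! ### Small lemmas -/

section Lemmas

variable {L : Type v} [Field L]

/-- `tr(E_{ij} z) = z_{ji}`. [folklore] -/
theorem trace_single_mul (i j : Fin 2) (z : Matrix (Fin 2) (Fin 2) L) :
    Matrix.trace (Matrix.single i j (1 : L) * z) = z j i := by
  classical
  rw [Matrix.trace, Fin.sum_univ_two]
  fin_cases i <;> simp

/-- Monic polynomials over a field with equal squares are equal. [folklore] -/
theorem eq_of_sq_eq_sq_of_monic {P Q : L[X]} (hP : P.Monic) (hQ : Q.Monic) (h : P ^ 2 = Q ^ 2) :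
    P = Q := by
  have h1 : (P - Q) * (P + Q) = 0 := by linear_combination h
  rcases mul_eq_zero.mp h1 with h2 | h2
  · exact sub_eq_zero.mp h2
  · have hPQ : P = -Q := eq_neg_of_add_eq_zero_left h2
    have hlc : (1 : L) = -1 := by
      have := congrArg Polynomial.leadingCoeff hPQ
      rwa [Polynomial.leadingCoeff_neg, hP.leadingCoeff, hQ.leadingCoeff] at this
    rw [hPQ, neg_eq_neg_one_mul, ← C_1, ← C_neg, ← hlc, C_1, one_mul]

/-- `1 × 1` matrices over a commutative(-multiplication) ring commute. [folklore] -/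
theorem matrix_fin_one_comm {D : Type*} [NonUnitalNonAssocSemiring D]
    (hD : ∀ a b : D, a * b = b * a) (P Q : Matrix (Fin 1) (Fin 1) D) : P * Q = Q * P := by
  ext i j
  fin_cases i; fin_cases j
  simp [Matrix.mul_apply, hD]

end Lemmas

/-! ### The absolutely irreducible case -/

section AbsIrred

variable {k : Type u} [Field k] [Fintype k] {L : Type v} [Field L] [IsAlgClosed L]
  (j : k →+* L) {G : Type w} [Group G]

set_option maxHeartbeats 3200000 in
/-- **Descent to `k` of an absolutely irreducible two-dimensional representation with
characteristic polynomials in `k[X]`** (Deligne–Serre 1974, Lemme 6.13 for `n = 2`, absolutely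
irreducible case, characteristic-polynomial form): for `φ : G → GL₂(L)`, `L` algebraically
closed, without common eigenvector and with `det(X - φ(g)) ∈ k[X]` for all `g`, there is
`ρ : G → GL₂(k)` with `ker φ ≤ ker ρ` and `det(X - ρ(g)) ↦ det(X - φ(g))`. Proof: Burnside
(`span_eq_top_of_no_common_eigenvector`), the trace form, Wedderburn–Artin
(`IsSimpleRing.exists_algEquiv_matrix_divisionRing_finite`) and Wedderburn's little theorem
(`littleWedderburn`), as in op. cit. [cite: DeligneSerreASENS1974, Lemme 6.13] -/
theorem exists_descent_fin_two_of_no_common_eigenvector (φ : G →* GL (Fin 2) L)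
    (hφ : ∀ g, ∃ Q : k[X], Q.map j = ((φ g : GL (Fin 2) L) : Matrix (Fin 2) (Fin 2) L).charpoly)
    (hirr : ∀ v : Fin 2 → L, v ≠ 0 →
      ∃ g, ((φ g : GL (Fin 2) L) : Matrix (Fin 2) (Fin 2) L) *ᵥ v ∉ L ∙ v) :
    ∃ ρ : G →* GL (Fin 2) k, φ.ker ≤ ρ.ker ∧
      ∀ g, (((ρ g : GL (Fin 2) k) : Matrix (Fin 2) (Fin 2) k).charpoly).map j =
        ((φ g : GL (Fin 2) L) : Matrix (Fin 2) (Fin 2) L).charpoly := by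
  classical
  -- ### notation, the field `F = j(k)`
  set M : G → Matrix (Fin 2) (Fin 2) L := fun g ↦ ((φ g : GL (Fin 2) L) : Matrix (Fin 2) (Fin 2) L)
    with hMdef
  let Mhom : G →* Matrix (Fin 2) (Fin 2) L := (Units.coeHom _).comp φ
  have hMhom : ⇑Mhom = M := rfl
  have hMmul : ∀ g h, M (g * h) = M g * M h := fun g h ↦ by
    simp only [hMdef, map_mul, Units.val_mul]
  have hMone : M 1 = 1 := by simp only [hMdef, map_one, Units.val_one]
  have hBurn : Submodule.span L (Set.range M) = ⊤ := span_eq_top_of_no_common_eigenvector φ hirr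
  let jinv : L → k := fun y ↦ if h : ∃ x, j x = y then h.choose else 0
  have hjinv : ∀ y : L, y ∈ j.fieldRange → j (jinv y) = y := fun y hy ↦ by
    have h := (RingHom.mem_fieldRange.mp hy)
    simp only [jinv, dif_pos h]
    exact h.choose_spec
  have hjmem : ∀ x : k, j x ∈ j.fieldRange := fun x ↦ RingHom.mem_fieldRange.mpr ⟨x, rfl⟩
  -- traces lie in `F`
  have htrF : ∀ g, (M g).trace ∈ j.fieldRange := by
    intro g
    obtain ⟨Q, hQ⟩ := hφ g
    have h1 : (Q.map j).coeff 1 = -(M g).trace := by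
      rw [hQ, show ((φ g : GL (Fin 2) L) : Matrix (Fin 2) (Fin 2) L) = M g from rfl,
        Matrix.charpoly_fin_two]
      simp [coeff_C, coeff_X_pow]
    rw [Polynomial.coeff_map] at h1
    have h2 : (M g).trace = j (-Q.coeff 1) := by rw [map_neg, h1, neg_neg]
    rw [h2]; exact hjmem _
  -- ### an `L`-basis of `M₂(L)` made of matrices `M g`
  obtain ⟨κ, a, -, hspan, hli⟩ := exists_linearIndependent' L M
  rw [hBurn] at hspan
  haveI : Finite κ := hli.finite
  letI : Fintype κ := Fintype.ofFinite κ
  let bL : Basis κ L (Matrix (Fin 2) (Fin 2) L) := Basis.mk hli (by rw [hspan])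
  have hbL : ∀ x, bL x = M (a x) := fun x ↦ by simp only [bL, Basis.mk_apply, Function.comp_apply]
  have hcard : Fintype.card κ = 4 := by
    have h1 := Module.finrank_eq_card_basis bL
    have h2 := Module.finrank_eq_card_basis (Matrix.stdBasis L (Fin 2) (Fin 2))
    rw [h1] at h2
    simpa using h2
  -- ### the trace form
  let T : Matrix κ κ L := Matrix.of fun x y ↦ (bL x * bL y).trace
  have hTF : ∀ x y, T x y ∈ j.fieldRange := fun x y ↦ by
    change (bL x * bL y).trace ∈ _
    rw [hbL, hbL, ← hMmul]; exact htrF _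
  have hTsymm : ∀ x y, T x y = T y x := fun x y ↦ by
    change (bL x * bL y).trace = (bL y * bL x).trace
    exact Matrix.trace_mul_comm _ _
  -- `tr(m z)` is linear in `m`, computed on the basis
  have htr_lin : ∀ (m z : Matrix (Fin 2) (Fin 2) L),
      (m * z).trace = ∑ x, bL.repr m x * (bL x * z).trace := by
    intro m z
    conv_lhs => rw [← bL.sum_repr m]
    rw [Finset.sum_mul, Matrix.trace_sum]
    refine Finset.sum_congr rfl fun x _ ↦ ?_
    rw [Matrix.smul_mul, Matrix.trace_smul, smul_eq_mul]
  have hTinj : ∀ c : κ → L, T *ᵥ c = 0 → c = 0 := by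
    intro c hc
    set z : Matrix (Fin 2) (Fin 2) L := ∑ y, c y • bL y with hz
    have hz1 : ∀ x, (bL x * z).trace = 0 := by
      intro x
      have := congrFun hc x
      rw [Matrix.mulVec, Pi.zero_apply] at this
      change (∑ y, (bL x * bL y).trace * c y) = 0 at this
      rw [hz, Matrix.mul_sum, Matrix.trace_sum, ← this]
      refine Finset.sum_congr rfl fun y _ ↦ ?_
      rw [Matrix.mul_smul, Matrix.trace_smul, smul_eq_mul, mul_comm]
    have hz2 : ∀ m : Matrix (Fin 2) (Fin 2) L, (m * z).trace = 0 := by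
      intro m
      rw [htr_lin]
      exact Finset.sum_eq_zero fun x _ ↦ by rw [hz1, mul_zero]
    have hz3 : z = 0 := by
      ext i i'
      have := hz2 (Matrix.single i' i 1)
      rwa [trace_single_mul] at this
    have := bL.repr_sum_self c
    rw [← hz, hz3, map_zero] at this
    exact funext fun x ↦ by have h := congrFun this x; simpa using h.symm
  have hTdet : T.det ≠ 0 := by
    intro h
    obtain ⟨c, hc0, hc⟩ := Matrix.exists_mulVec_eq_zero_iff.mpr h
    exact hc0 (hTinj c hc)
  -- `T = T₀.map j`
  let T₀ : Matrix κ κ k := Matrix.of fun x y ↦ jinv (T x y)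
  have hT₀ : T₀.map j = T := by
    ext x y
    exact hjinv _ (hTF x y)
  have hT₀det : IsUnit T₀.det := by
    rw [isUnit_iff_ne_zero]
    intro h
    apply hTdet
    rw [← hT₀]
    change (j.mapMatrix T₀).det = 0
    rw [← RingHom.map_det, h, map_zero]
  -- ### the coordinates of every `M g` lie in `F`
  have hcoordF : ∀ g x, bL.repr (M g) x ∈ j.fieldRange := by
    intro g
    set c : κ → L := fun x ↦ bL.repr (M g) x with hcdef
    set r : κ → L := fun y ↦ (M g * bL y).trace with hrdef
    have hrF : ∀ y, r y ∈ j.fieldRange := fun y ↦ by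
      change (M g * bL y).trace ∈ _
      rw [hbL, ← hMmul]; exact htrF _
    have hTc : T *ᵥ c = r := by
      funext y
      rw [Matrix.mulVec]
      change (∑ x, (bL y * bL x).trace * c x) = (M g * bL y).trace
      rw [htr_lin]
      refine Finset.sum_congr rfl fun x _ ↦ ?_
      rw [mul_comm, Matrix.trace_mul_comm (bL x) (bL y)]
    let r₀ : κ → k := fun y ↦ jinv (r y)
    have hr₀ : (j ∘ r₀) = r := funext fun y ↦ hjinv _ (hrF y)
    let c₀ : κ → k := T₀⁻¹ *ᵥ r₀
    have hTc₀ : T *ᵥ (j ∘ c₀) = r := by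
      funext y
      rw [← hT₀, ← RingHom.map_mulVec, Matrix.mulVec_mulVec, Matrix.mul_nonsing_inv _ hT₀det,
        Matrix.one_mulVec]
      exact congrFun hr₀ y
    have hcc₀ : c = j ∘ c₀ := by
      have h1 : T *ᵥ (c - j ∘ c₀) = 0 := by rw [Matrix.mulVec_sub, hTc, hTc₀, sub_self]
      have := hTinj _ h1
      exact sub_eq_zero.mp this
    intro x
    change c x ∈ _
    rw [hcc₀]; exact hjmem _
  -- ### the `k`-algebra `A` spanned by the `M g`
  letI : Algebra k L := j.toAlgebra
  have halg : ∀ r : k, algebraMap k L r = j r := fun _ ↦ rfl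
  haveI : FaithfulSMul k L := (faithfulSMul_iff_algebraMap_injective k L).mpr j.injective
  let A : Subalgebra k (Matrix (Fin 2) (Fin 2) L) := Algebra.adjoin k (Set.range M)
  have hAM : ∀ g, M g ∈ A := fun g ↦ Algebra.subset_adjoin ⟨g, rfl⟩
  have hksmul : ∀ (r : k) (m : Matrix (Fin 2) (Fin 2) L), r • m = j r • m := fun r m ↦
    algebra_compatible_smul L r m
  -- every element of `A` is a `k`-combination of the basis matrices
  have hAspan : Subalgebra.toSubmodule A = Submodule.span k (Set.range (M ∘ a)) := by
    apply le_antisymm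
    · change Subalgebra.toSubmodule (Algebra.adjoin k (Set.range M)) ≤ _
      rw [Algebra.adjoin_eq_span, show Set.range M = (MonoidHom.mrange Mhom : Set _) by
        rw [MonoidHom.coe_mrange, hMhom], Submonoid.closure_eq, Submodule.span_le,
        MonoidHom.coe_mrange, hMhom]
      rintro _ ⟨g, rfl⟩
      rw [← bL.sum_repr (M g)]
      refine Submodule.sum_mem _ fun x _ ↦ ?_
      obtain ⟨r, hr⟩ := RingHom.mem_fieldRange.mp (hcoordF g x)
      rw [← hr, ← hksmul, hbL]
      exact Submodule.smul_mem _ _ (Submodule.subset_span ⟨x, rfl⟩)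
    · rw [Submodule.span_le]
      rintro _ ⟨x, rfl⟩
      exact hAM _
  -- the `k`-basis of `A`
  let v : κ → A := fun x ↦ ⟨M (a x), hAM _⟩
  have hvli : LinearIndependent k v := by
    apply LinearIndependent.of_comp A.val.toLinearMap
    have : (A.val.toLinearMap : A → Matrix (Fin 2) (Fin 2) L) ∘ v = M ∘ a := rfl
    rw [this]
    exact hli.restrict_scalars' k
  have hvsp : ⊤ ≤ Submodule.span k (Set.range v) := by
    rintro y -
    have hy : (y : Matrix (Fin 2) (Fin 2) L) ∈ Submodule.span k (Set.range (M ∘ a)) := by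
      rw [← hAspan]; exact y.2
    have himg : Set.range (M ∘ a) = A.val.toLinearMap '' Set.range v := by
      rw [← Set.range_comp]; rfl
    rw [himg] at hy
    change A.val.toLinearMap y ∈ _ at hy
    rwa [Submodule.apply_mem_span_image_iff_mem_span Subtype.val_injective] at hy
  let bk : Basis κ k A := Basis.mk hvli hvsp
  have hbk : ∀ x, ((bk x : A) : Matrix (Fin 2) (Fin 2) L) = bL x := fun x ↦ by
    rw [hbL]; simp only [bk, Basis.mk_apply, v]
  haveI : Module.Finite k A := Module.Finite.of_basis bk
  have hfinA : finrank k A = 4 := by rw [Module.finrank_eq_card_basis bk, hcard]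
  -- coordinates over `k` and over `L` agree
  have hrepr : ∀ (y : A) (x : κ), bL.repr (y : Matrix (Fin 2) (Fin 2) L) x = j (bk.repr y x) := by
    intro y x
    have h1 : (y : Matrix (Fin 2) (Fin 2) L) = ∑ z, j (bk.repr y z) • bL z := by
      conv_lhs => rw [← bk.sum_repr y]
      rw [show (((∑ z, bk.repr y z • bk z : A)) : Matrix (Fin 2) (Fin 2) L) =
          ∑ z, (((bk.repr y z • bk z : A)) : Matrix (Fin 2) (Fin 2) L) from map_sum A.val _ _]
      refine Finset.sum_congr rfl fun z _ ↦ ?_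
      rw [Subalgebra.coe_smul, hksmul, hbk]
    rw [h1, bL.repr_sum_self]
  -- ### `A` is a simple ring
  -- two-sided closure of the `L`-span of a two-sided ideal of `A`
  have hspanI : ∀ I : TwoSidedIdeal A, I ≠ ⊥ →
      Submodule.span L ((fun i : A ↦ (i : Matrix (Fin 2) (Fin 2) L)) '' (I : Set A)) = ⊤ := by
    intro I hI
    set S := Submodule.span L ((fun i : A ↦ (i : Matrix (Fin 2) (Fin 2) L)) '' (I : Set A))
      with hSdef
    have hleft : ∀ x y : Matrix (Fin 2) (Fin 2) L, y ∈ S → x * y ∈ S := by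
      intro x y hy
      induction hy using Submodule.span_induction with
      | mem y hy =>
        obtain ⟨i, hi, rfl⟩ := hy
        have hx : x ∈ Submodule.span L (Set.range M) := by rw [hBurn]; exact Submodule.mem_top
        induction hx using Submodule.span_induction with
        | mem x hx =>
          obtain ⟨g, rfl⟩ := hx
          refine Submodule.subset_span ⟨⟨M g, hAM g⟩ * i, I.mul_mem_left _ _ hi, ?_⟩
          rfl
        | zero => rw [zero_mul]; exact Submodule.zero_mem _
        | add x x' _ _ hx hx' => rw [add_mul]; exact Submodule.add_mem _ hx hx'
        | smul c x _ hx => rw [smul_mul_assoc]; exact Submodule.smul_mem _ _ hx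
      | zero => rw [mul_zero]; exact Submodule.zero_mem _
      | add y y' _ _ hy hy' => rw [mul_add]; exact Submodule.add_mem _ hy hy'
      | smul c y _ hy => rw [mul_smul_comm]; exact Submodule.smul_mem _ _ hy
    have hright : ∀ x y : Matrix (Fin 2) (Fin 2) L, x ∈ S → x * y ∈ S := by
      intro x y hx
      induction hx using Submodule.span_induction with
      | mem x hx =>
        obtain ⟨i, hi, rfl⟩ := hx
        have hy : y ∈ Submodule.span L (Set.range M) := by rw [hBurn]; exact Submodule.mem_top
        induction hy using Submodule.span_induction with
        | mem y hy =>
          obtain ⟨g, rfl⟩ := hy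
          refine Submodule.subset_span ⟨i * ⟨M g, hAM g⟩, I.mul_mem_right _ _ hi, ?_⟩
          rfl
        | zero => rw [mul_zero]; exact Submodule.zero_mem _
        | add y y' _ _ hy hy' => rw [mul_add]; exact Submodule.add_mem _ hy hy'
        | smul c y _ hy => rw [mul_smul_comm]; exact Submodule.smul_mem _ _ hy
      | zero => rw [zero_mul]; exact Submodule.zero_mem _
      | add x x' _ _ hx hx' => rw [add_mul]; exact Submodule.add_mem _ hx hx'
      | smul c x _ hx => rw [smul_mul_assoc]; exact Submodule.smul_mem _ _ hx
    let J : TwoSidedIdeal (Matrix (Fin 2) (Fin 2) L) :=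
      TwoSidedIdeal.mk' (S : Set (Matrix (Fin 2) (Fin 2) L)) (Submodule.zero_mem _)
        (fun hx hy ↦ Submodule.add_mem _ hx hy) (fun hx ↦ Submodule.neg_mem _ hx)
        (fun {x y} hy ↦ hleft x y hy) (fun {x y} hx ↦ hright x y hx)
    have hJmem : ∀ x, x ∈ J ↔ x ∈ S := fun x ↦ by
      simp only [J, TwoSidedIdeal.mem_mk', SetLike.mem_coe]
    have hJ : J ≠ ⊥ := by
      intro h
      apply hI
      rw [eq_bot_iff]
      intro i hi
      have : (i : Matrix (Fin 2) (Fin 2) L) ∈ J := (hJmem _).mpr (Submodule.subset_span ⟨i, hi, rfl⟩)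
      rw [h, TwoSidedIdeal.mem_bot] at this
      rw [TwoSidedIdeal.mem_bot]
      exact Subtype.ext this
    have hJtop : J = ⊤ := (eq_bot_or_eq_top J).resolve_left hJ
    rw [eq_top_iff]
    rintro x -
    rw [← hJmem, hJtop]; trivial
  haveI hAsimple : IsSimpleRing A := by
    haveI : Nontrivial (TwoSidedIdeal A) := ⟨⟨⊥, ⊤, fun h ↦ by
      have : (1 : A) ∈ (⊥ : TwoSidedIdeal A) := by rw [h]; trivial
      rw [TwoSidedIdeal.mem_bot] at this
      exact one_ne_zero this⟩⟩
    refine ⟨⟨fun I ↦ ?_⟩⟩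
    by_cases hI : I = ⊥
    · exact Or.inl hI
    right
    -- `I` has `k`-dimension `4`
    have hS := hspanI I hI
    obtain ⟨κ', a', -, hspan', hli'⟩ :=
      exists_linearIndependent' L (fun i : (I : Set A) ↦ ((i : A) : Matrix (Fin 2) (Fin 2) L))
    rw [← Set.image_eq_range] at hspan'
    rw [hS] at hspan'
    haveI : Finite κ' := hli'.finite
    letI : Fintype κ' := Fintype.ofFinite κ'
    let bL' : Basis κ' L (Matrix (Fin 2) (Fin 2) L) := Basis.mk hli' (by rw [hspan'])
    have hcard' : Fintype.card κ' = 4 := by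
      have h1 := Module.finrank_eq_card_basis bL'
      have h2 := Module.finrank_eq_card_basis (Matrix.stdBasis L (Fin 2) (Fin 2))
      rw [h1] at h2
      simpa using h2
    let Ik : Submodule k A :=
      { carrier := I
        add_mem' := fun hx hy ↦ I.add_mem hx hy
        zero_mem' := I.zero_mem
        smul_mem' := fun c x hx ↦ by
          rw [Algebra.smul_def]; exact I.mul_mem_left _ _ hx }
    let v' : κ' → Ik := fun t ↦ ⟨(a' t : A), (a' t).2⟩
    have hv'li : LinearIndependent k v' := by
      apply LinearIndependent.of_comp (A.val.toLinearMap ∘ₗ Ik.subtype)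
      have : ((A.val.toLinearMap ∘ₗ Ik.subtype : Ik →ₗ[k] Matrix (Fin 2) (Fin 2) L) ∘ v') =
          (fun i : (I : Set A) ↦ ((i : A) : Matrix (Fin 2) (Fin 2) L)) ∘ a' := rfl
      rw [this]
      exact hli'.restrict_scalars' k
    have hIk : Ik = ⊤ := by
      apply Submodule.eq_top_of_finrank_eq
      apply le_antisymm (Submodule.finrank_le Ik)
      rw [hfinA, ← hcard']
      exact hv'li.fintype_card_le_finrank
    have h1 : (1 : A) ∈ I := by
      change (1 : A) ∈ Ik
      rw [hIk]; exact Submodule.mem_top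
    exact (TwoSidedIdeal.one_mem_iff I).mp h1
  -- ### Wedderburn–Artin and Wedderburn's little theorem: `A ≅ M₂(k)`
  haveI : IsArtinianRing A := IsArtinianRing.of_finite k A
  obtain ⟨n, hn, D, _, _, _, ⟨e⟩⟩ := IsSimpleRing.exists_algEquiv_matrix_divisionRing_finite k A
  haveI : Finite D := Module.finite_of_finite k
  have hDcomm : ∀ x y : D, x * y = y * x := fun x y ↦ (littleWedderburn D).mul_comm x y
  have hdim : n * n * finrank k D = 4 := by
    rw [← hfinA, e.toLinearEquiv.finrank_eq, Module.finrank_matrix]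
    simp
  have hDpos : 0 < finrank k D := Module.finrank_pos
  have hn0 : n ≠ 0 := hn.ne
  have hn2 : n = 2 ∧ finrank k D = 1 := by
    have hnle : n ≤ 2 := by nlinarith
    interval_cases n
    · exact absurd rfl hn0
    · -- `n = 1`: `A` is commutative, so the `M g` commute and have a common eigenvector
      exfalso
      have hcomm : ∀ x y : A, x * y = y * x := by
        intro x y
        apply e.injective
        rw [map_mul, map_mul]
        exact matrix_fin_one_comm hDcomm _ _
      obtain ⟨w, hw0, hw⟩ := exists_common_eigenvector_of_commute (Set.range M) (by
        rintro _ ⟨g, rfl⟩ _ ⟨h, rfl⟩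
        exact congrArg Subtype.val (hcomm ⟨M g, hAM g⟩ ⟨M h, hAM h⟩))
      obtain ⟨g, hg⟩ := hirr w hw0
      exact hg (hw _ ⟨g, rfl⟩)
    · exact ⟨rfl, by omega⟩
  obtain ⟨rfl, hD1⟩ := hn2
  have hDbij : Function.Bijective (Algebra.ofId k D) := by
    refine ⟨(algebraMap k D).injective, fun w ↦ ?_⟩
    obtain ⟨c, hc⟩ := (finrank_eq_one_iff_of_nonzero' (1 : D) one_ne_zero).mp hD1 w
    exact ⟨c, by rw [Algebra.ofId_apply, Algebra.algebraMap_eq_smul_one, hc]⟩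
  let θ : A ≃ₐ[k] Matrix (Fin 2) (Fin 2) k :=
    e.trans (AlgEquiv.mapMatrix (AlgEquiv.ofBijective (Algebra.ofId k D) hDbij).symm)
  -- ### characteristic polynomials through the left regular representation
  have hcharθ : ∀ y : A, ((θ y).charpoly).map j = (y : Matrix (Fin 2) (Fin 2) L).charpoly := by
    intro y
    -- over `k`: `det(X - ℓ_y) = det(X - θ y)²`
    have h1 : (LinearMap.mulLeft k (θ y)).charpoly = (LinearMap.mulLeft k y).charpoly := by
      have : LinearMap.mulLeft k (θ y) = θ.toLinearEquiv.conj (LinearMap.mulLeft k y) := by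
        apply LinearMap.ext; intro m
        rw [LinearEquiv.conj_apply_apply, LinearMap.mulLeft_apply, LinearMap.mulLeft_apply,
          AlgEquiv.toLinearEquiv_apply, map_mul]
        change θ y * m = θ y * θ (θ.symm m)
        rw [AlgEquiv.apply_symm_apply]
      rw [this, LinearEquiv.charpoly_conj]
    have h2 := charpoly_mulLeft_fin_two (θ y)
    -- over `L`: base change along `j`
    have h3 : ((LinearMap.mulLeft k y).charpoly).map j =
        (LinearMap.mulLeft L (y : Matrix (Fin 2) (Fin 2) L)).charpoly := by
      rw [← LinearMap.charpoly_toMatrix (LinearMap.mulLeft k y) bk,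
        ← LinearMap.charpoly_toMatrix (LinearMap.mulLeft L (y : Matrix (Fin 2) (Fin 2) L)) bL,
        ← Matrix.charpoly_map]
      congr 1
      ext i l
      rw [Matrix.map_apply, LinearMap.toMatrix_apply, LinearMap.toMatrix_apply,
        LinearMap.mulLeft_apply, LinearMap.mulLeft_apply, ← hrepr, Subalgebra.coe_mul, hbk]
    have h4 := charpoly_mulLeft_fin_two (y : Matrix (Fin 2) (Fin 2) L)
    have h5 : ((θ y).charpoly.map j) ^ 2 = ((y : Matrix (Fin 2) (Fin 2) L).charpoly) ^ 2 := by
      rw [← Polynomial.map_pow, ← h2, h1, h3, h4]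
    exact eq_of_sq_eq_sq_of_monic ((Matrix.charpoly_monic _).map j) (Matrix.charpoly_monic _) h5
  -- ### the representation `ρ = θ ∘ φ`
  let φA : G →* Aˣ :=
    { toFun := fun g ↦ ⟨⟨M g, hAM g⟩, ⟨M g⁻¹, hAM _⟩,
        Subtype.ext (by change M g * M g⁻¹ = 1; rw [← hMmul, mul_inv_cancel, hMone]),
        Subtype.ext (by change M g⁻¹ * M g = 1; rw [← hMmul, inv_mul_cancel, hMone])⟩
      map_one' := Units.ext (Subtype.ext hMone)
      map_mul' := fun g h ↦ Units.ext (Subtype.ext (hMmul g h)) }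
  have hφA : ∀ g, ((φA g : Aˣ) : A) = ⟨M g, hAM g⟩ := fun _ ↦ rfl
  let ρ : G →* GL (Fin 2) k := (Units.map (θ : A ≃ₐ[k] Matrix (Fin 2) (Fin 2) k).toMonoidHom).comp φA
  have hρ : ∀ g, ((ρ g : GL (Fin 2) k) : Matrix (Fin 2) (Fin 2) k) = θ ⟨M g, hAM g⟩ := fun _ ↦ rfl
  refine ⟨ρ, fun g hg ↦ ?_, fun g ↦ ?_⟩
  · rw [MonoidHom.mem_ker] at hg ⊢
    have h1 : φA g = 1 := Units.ext (Subtype.ext (by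
      rw [hφA]; change M g = 1; simp only [hMdef, hg, Units.val_one]))
    change (Units.map (θ : A ≃ₐ[k] Matrix (Fin 2) (Fin 2) k).toMonoidHom) (φA g) = 1
    rw [h1, map_one]
  · rw [hρ, hcharθ]

end AbsIrred

/-! ### Descent over an arbitrary field -/

section General

variable {k : Type u} [Field k] [Fintype k] {K : Type v} [Field K] (j : k →+* K)
  {G : Type w} [Group G]

/-- **Deligne–Serre 1974, Lemme 6.13 (`n = 2`), characteristic-polynomial form.** Let `k` be a
finite field, `j : k → K` a field extension and `φ : G → GL₂(K)` a homomorphism all of whose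
characteristic polynomials lie in `k[X]`. Then there is `ρ : G → GL₂(k)` with `ker φ ≤ ker ρ`
and `det(X - ρ(g)) ↦ det(X - φ(g))` for all `g` (so that, after semisimplification, `ρ ⊗ K`
and the semisimplification of `φ` are isomorphic by Brauer–Nesbitt; op. cit. states the lemma
for `φ` semisimple over a finite `K` with the conclusion "`φ` est réalisable sur `k`"). Proof:
over an algebraic closure, either there is a common eigenvector
(`exists_descent_fin_two_of_common_eigenvector`) or not
(`exists_descent_fin_two_of_no_common_eigenvector`). [cite: DeligneSerreASENS1974, Lemme 6.13] -/
theorem exists_descent_fin_two (φ : G →* GL (Fin 2) K)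
    (hφ : ∀ g, ∃ Q : k[X], Q.map j = ((φ g : GL (Fin 2) K) : Matrix (Fin 2) (Fin 2) K).charpoly) :
    ∃ ρ : G →* GL (Fin 2) k, φ.ker ≤ ρ.ker ∧
      ∀ g, (((ρ g : GL (Fin 2) k) : Matrix (Fin 2) (Fin 2) k).charpoly).map j =
        ((φ g : GL (Fin 2) K) : Matrix (Fin 2) (Fin 2) K).charpoly := by
  classical
  let L := AlgebraicClosure K
  let ι : K →+* L := algebraMap K L
  let φL : G →* GL (Fin 2) L := (Matrix.GeneralLinearGroup.map ι).comp φ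
  have hφL : ∀ g, ((φL g : GL (Fin 2) L) : Matrix (Fin 2) (Fin 2) L) =
      ((φ g : GL (Fin 2) K) : Matrix (Fin 2) (Fin 2) K).map ι := fun _ ↦ rfl
  have hcharL : ∀ g, ((φL g : GL (Fin 2) L) : Matrix (Fin 2) (Fin 2) L).charpoly =
      (((φ g : GL (Fin 2) K) : Matrix (Fin 2) (Fin 2) K).charpoly).map ι := fun g ↦ by
    rw [hφL, Matrix.charpoly_map]
  have hφL' : ∀ g, ∃ Q : k[X], Q.map (ι.comp j) =
      ((φL g : GL (Fin 2) L) : Matrix (Fin 2) (Fin 2) L).charpoly := fun g ↦ by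
    obtain ⟨Q, hQ⟩ := hφ g
    exact ⟨Q, by rw [← Polynomial.map_map, hQ, hcharL]⟩
  have hkerL : φ.ker ≤ φL.ker := fun g hg ↦ by
    rw [MonoidHom.mem_ker] at hg ⊢
    change Matrix.GeneralLinearGroup.map ι (φ g) = 1
    rw [hg, map_one]
  have hconc : ∀ ρ : G →* GL (Fin 2) k, φL.ker ≤ ρ.ker →
      (∀ g, (((ρ g : GL (Fin 2) k) : Matrix (Fin 2) (Fin 2) k).charpoly).map (ι.comp j) =
        ((φL g : GL (Fin 2) L) : Matrix (Fin 2) (Fin 2) L).charpoly) →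
      φ.ker ≤ ρ.ker ∧ ∀ g, (((ρ g : GL (Fin 2) k) : Matrix (Fin 2) (Fin 2) k).charpoly).map j =
        ((φ g : GL (Fin 2) K) : Matrix (Fin 2) (Fin 2) K).charpoly := by
    intro ρ hker hchar
    refine ⟨hkerL.trans hker, fun g ↦ ?_⟩
    apply Polynomial.map_injective ι ι.injective
    rw [Polynomial.map_map, hchar, hcharL]
  by_cases h : ∃ v : Fin 2 → L, v ≠ 0 ∧
      ∀ g, ((φL g : GL (Fin 2) L) : Matrix (Fin 2) (Fin 2) L) *ᵥ v ∈ L ∙ v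
  · obtain ⟨v, hv, heig⟩ := h
    obtain ⟨ρ, hker, hchar⟩ := exists_descent_fin_two_of_common_eigenvector (ι.comp j) φL hφL' hv heig
    exact ⟨ρ, hconc ρ hker hchar⟩
  · push Not at h
    obtain ⟨ρ, hker, hchar⟩ := exists_descent_fin_two_of_no_common_eigenvector (ι.comp j) φL hφL'
      (fun v hv ↦ h v hv)
    exact ⟨ρ, hconc ρ hker hchar⟩

end General

end Literature.RepresentationTheory.Semisimple
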